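import Mathlib
import HarnessLib

/-!
# The geometric-difference test for quantum-kernel advantage: `s_{K¹} ≤ g₁₂² · s_{K²}`

Huang, Broughton, Mohseni, Babbush, Boixo, Neven, McClean, *Power of data in quantum machine learning*,
Nat. Commun. **12**, 2631 (2021) = arXiv:2011.01938, Results §"Testing quantum advantage" / Methods and
Supplementary §11.3 ("Geometric difference g").  Instance-level adjudication context (lane pub-qadeq): this is
the published "first step of the flowchart" by which a quantum-kernel advantage claim on a concrete data set is
screened — if the geometric difference between the classical and the quantum kernel matrix is small, "the
classical ML model will always have a similar or better model complexity" and hence a similar or better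
prediction-error bound.  Nothing here is a statement about BQP vs BPP.

Printed statements (main text, p. 3 of the arXiv version):
* model complexity `s_K = Σᵢⱼ (K⁻¹)ᵢⱼ yᵢ yⱼ` of the labels `yᵢ = tr(O^U ρ(xᵢ))` under the kernel matrix `K`
  ("`s_K` is equal to the model complexity of the trained function `h(x) = w†φ(x)`, where `s_K = ‖w‖²`");
* geometric difference `g₁₂ = g(K¹ ‖ K²) = √‖ √K² (K¹)⁻¹ √K² ‖_∞` ("where `‖·‖_∞` is the spectral norm");
* "One can show that `s_{K¹} ≤ g₁₂² s_{K²}`, which implies the prediction error bound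
  `c√(s_{K¹}/N) ≤ c g₁₂ √(s_{K²}/N)`", specialised to `s_C ≤ g_{CQ}² s_Q` for a classical kernel `K^C` and the
  quantum kernel `K^Q_{ij} = tr(ρ(xᵢ)ρ(xⱼ))`; Supplementary §11.4: the engineered data set `y = √K^Q v`, `v` the
  top eigenvector, SATURATES the inequality (`s_C = g² s_Q`).

What is formalised (real symmetric kernel matrices, as in the paper's numerics; all PROVED, no named facts):
* `modelComplexity K y = y ⬝ᵥ K⁻¹ y` (= `s_K`);
* `modelComplexity_le_of_loewner` — for `K¹` positive definite and `S` a positive-definite square root of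
  `K² = S·S` (the paper's `√K²`), if `S (K¹)⁻¹ S ≤ λ·1` in the Loewner order then `s_{K¹}(y) ≤ λ · s_{K²}(y)`
  for every label vector `y`.  The printed `g₁₂²` is the spectral norm of the positive-semidefinite matrix
  `A = √K² (K¹)⁻¹ √K²`, i.e. the LEAST `λ` with `A ≤ λ·1`; the theorem is stated for any admissible `λ`, which is
  exactly how the inequality is used (TODO(general form): identify the least `λ` with Mathlib's L2 operator
  norm of `A`; complex Hermitian kernels);
* `modelComplexity_sq_root` — the change of variables of the printed proof, `s_{K²}(S v) = ‖v‖²`, and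
  `modelComplexity_eq_quadForm` — `s_{K¹}(S v) = v ⬝ᵥ (S (K¹)⁻¹ S) v`;
* `modelComplexity_eq_of_eigenvector` — saturation (Supplementary §11.4): if `A v = λ v` then the data set
  `y = S v` has `s_{K¹}(y) = λ · s_{K²}(y)`.
-/

namespace Literature.Computability.QuantumComplexity.KernelGeometricDifference

open Matrix
open scoped BigOperators

variable {n : Type*} [Fintype n] [DecidableEq n]

/-- The model complexity `s_K = Σᵢⱼ (K⁻¹)ᵢⱼ yᵢ yⱼ = yᵀ K⁻¹ y` of a label vector `y` under the kernel (Gram)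
matrix `K` (Huang et al. 2021, eq. for `s_K` in "Testing quantum advantage"; `K⁻¹` is Mathlib's `nonsing_inv`,
which is the inverse for the positive-definite matrices considered). [cite: HuangEtAl2021PowerOfData, Results eq. (s_K)] -/
noncomputable def modelComplexity (K : Matrix n n ℝ) (y : n → ℝ) : ℝ := y ⬝ᵥ (K⁻¹ *ᵥ y)

/-- Unfolding lemma. [cite: HuangEtAl2021PowerOfData, Results eq. (s_K)] -/
theorem modelComplexity_eq (K : Matrix n n ℝ) (y : n → ℝ) : modelComplexity K y = y ⬝ᵥ (K⁻¹ *ᵥ y) := rfl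

omit [Fintype n] [DecidableEq n] in
/-- A real positive-definite matrix is symmetric. [folklore] -/
private theorem transpose_eq_of_posDef {S : Matrix n n ℝ} (hS : S.PosDef) : Sᵀ = S := by
  have h := hS.isHermitian.eq
  simpa using h

/-- A real positive-definite matrix has invertible determinant. [folklore] -/
private theorem isUnit_det_of_posDef {S : Matrix n n ℝ} (hS : S.PosDef) : IsUnit S.det :=
  isUnit_iff_ne_zero.mpr (Matrix.PosDef.det_pos hS).ne'

/-- Change of variables of the printed proof: for the square root `S` of `K² = S S` and `y = S v`,
`s_{K²}(y) = yᵀ (S S)⁻¹ y = vᵀ v`. [cite: HuangEtAl2021PowerOfData, Supplementary §11.3–11.4] -/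
theorem modelComplexity_sq_root {S : Matrix n n ℝ} (hS : S.PosDef) (v : n → ℝ) :
    modelComplexity (S * S) (S *ᵥ v) = v ⬝ᵥ v := by
  have hU := isUnit_det_of_posDef hS
  have hT := transpose_eq_of_posDef hS
  rw [modelComplexity_eq, Matrix.mul_inv_rev, Matrix.mulVec_mulVec, Matrix.mul_assoc,
    Matrix.nonsing_inv_mul _ hU, Matrix.mul_one, Matrix.dotProduct_mulVec, ← Matrix.vecMul_transpose,
    Matrix.vecMul_vecMul, hT, Matrix.mul_nonsing_inv _ hU, Matrix.vecMul_one]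

/-- … and `s_{K¹}(y) = vᵀ (S (K¹)⁻¹ S) v` — the quadratic form of the matrix whose spectral norm is `g₁₂²`.
[cite: HuangEtAl2021PowerOfData, Supplementary §11.3] -/
theorem modelComplexity_eq_quadForm (K₁ : Matrix n n ℝ) {S : Matrix n n ℝ} (hS : S.PosDef) (v : n → ℝ) :
    modelComplexity K₁ (S *ᵥ v) = v ⬝ᵥ ((S * K₁⁻¹ * S) *ᵥ v) := by
  have hT := transpose_eq_of_posDef hS
  rw [modelComplexity_eq, Matrix.mulVec_mulVec, Matrix.dotProduct_mulVec, ← Matrix.vecMul_transpose,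
    Matrix.vecMul_vecMul, hT, ← Matrix.mul_assoc, ← Matrix.dotProduct_mulVec]

/-- **`s_{K¹} ≤ g₁₂² · s_{K²}`** (Huang et al. 2021, "One can show that `s_{K¹} ≤ g₁₂² s_{K²}`"; in particular
`s_C ≤ g_{CQ}² s_Q`): for a positive-definite kernel matrix `K¹`, a positive-definite square root `S` of
`K² = S S`, and any `λ` dominating `A = S (K¹)⁻¹ S` in the Loewner order (`λ·1 − A` positive semidefinite — the
least such `λ` being the spectral norm `‖A‖_∞ = g₁₂²` of the printed definition), every label vector satisfies
`s_{K¹}(y) ≤ λ · s_{K²}(y)`. [cite: HuangEtAl2021PowerOfData, Results ("Testing quantum advantage"), Supplementary §11.3] -/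
theorem modelComplexity_le_of_loewner {K₁ S : Matrix n n ℝ} (hK₁ : K₁.PosDef) (hS : S.PosDef) {lam : ℝ}
    (hA : (lam • (1 : Matrix n n ℝ) - S * K₁⁻¹ * S).PosSemidef) (y : n → ℝ) :
    modelComplexity K₁ y ≤ lam * modelComplexity (S * S) y := by
  have hU := isUnit_det_of_posDef hS
  -- write `y = S v` with `v = S⁻¹ y`
  set v : n → ℝ := S⁻¹ *ᵥ y with hv
  have hy : y = S *ᵥ v := by
    rw [hv, Matrix.mulVec_mulVec, Matrix.mul_nonsing_inv _ hU, Matrix.one_mulVec]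
  rw [hy, modelComplexity_sq_root hS, modelComplexity_eq_quadForm K₁ hS]
  -- Loewner bound: 0 ≤ vᵀ(λ·1 − A)v = λ vᵀv − vᵀ A v
  have h0 := (Matrix.posSemidef_iff_dotProduct_mulVec.mp hA).2 v
  have hexp : star v ⬝ᵥ ((lam • (1 : Matrix n n ℝ) - S * K₁⁻¹ * S) *ᵥ v)
      = lam * (v ⬝ᵥ v) - v ⬝ᵥ ((S * K₁⁻¹ * S) *ᵥ v) := by
    rw [star_trivial, Matrix.sub_mulVec, dotProduct_sub, Matrix.smul_mulVec, Matrix.one_mulVec,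
      dotProduct_smul, smul_eq_mul]
  have _ := hK₁  -- `K¹` positive definite is the standing hypothesis of the paper (the inverse is a true inverse)
  linarith [h0, hexp]

/-- Saturation (Supplementary §11.4, the engineered data sets): if `v` is an eigenvector of
`A = S (K¹)⁻¹ S` with eigenvalue `λ`, the label vector `y = S v` ("the solution is given by `y = √K^Q v`")
attains `s_{K¹}(y) = λ · s_{K²}(y)`; with `λ = g²` the top eigenvalue this is "`s_C = g² s_Q`".
[cite: HuangEtAl2021PowerOfData, Supplementary §11.4] -/
theorem modelComplexity_eq_of_eigenvector (K₁ : Matrix n n ℝ) {S : Matrix n n ℝ} (hS : S.PosDef) {lam : ℝ}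
    {v : n → ℝ} (hv : (S * K₁⁻¹ * S) *ᵥ v = lam • v) :
    modelComplexity K₁ (S *ᵥ v) = lam * modelComplexity (S * S) (S *ᵥ v) := by
  rw [modelComplexity_eq_quadForm K₁ hS, hv, modelComplexity_sq_root hS, dotProduct_smul, smul_eq_mul]

end Literature.Computability.QuantumComplexity.KernelGeometricDifference
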